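import Literature.MathematicalPhysics.QuantumFieldTheory.Balaban1983to89.B9SupplySockB9P3ZdAllLettersZdPer
import Literature.MathematicalPhysics.QuantumFieldTheory.Balaban1983to89.B8LeafModelZd3SockPer
import Literature.MathematicalPhysics.QuantumFieldTheory.Balaban1983to89.B9SupplySockB9P3Zd
import Literature.MathematicalPhysics.QuantumFieldTheory.Balaban1983to89.B9SupplySockB9P3ZdDatum
import Literature.MathematicalPhysics.QuantumFieldTheory.Balaban1983to89.B9Eq321LandauOrthogonalZdPer

/-!
# `Balaban1983to89.B9SupplySockB9P3ZdPer` — [Balaban1985RegularSpaces] p. 86 «Theorem 3.3 of [4] implies the bounds (1.59)» ON THE TORUS `T_P` READ ON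
# `ℤᵈ`: THE PERIODIC-GUARDED JUNCTION SOCKET `SockB9P3Per` AT ONE PERIODIC MEMBER (`Ω 0 = univ`) FROM THE PERIODIC, DATUM-KEYED, FRAME-FREE BINDERS
# of the operator record — (3.27) `InvAtHIPer`, (3.69) `CurvAtInAk`, (3.20) `LandauAtUPer`, (3.16) `AvgAtP`, (3.47)@−3 `GlobAtIPer`, (3.45) `HolderAtIPer`,
# periodicity `PerAtU` —; the binder texts; and the inhabitants the genuine torus record `opsAllZdPer` already has

statement-level skeleton of published theorems with citation tags; proofs where landed; nothing here is a claim about the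
Yang–Mills mass gap

`[Balaban1985RegularSpaces]` ("B8", CMP **99** (1985) 75–102): p. 77 (*«we admit the case when some domains Ω_j are equal to T_η»*), (1.7) p. 77, (1.38),
(1.40)–(1.42) pp. 82–83, (1.57)–(1.59) p. 86 (*«A = G(U₀)J − G(U₀)(Q*aQA) … Theorem 3.3 of [4] implies the bounds (1.59)»*).
`[Balaban1985BackgroundPropagators]` ("B9") (3.16) p. 393, (3.20)–(3.22) p. 394, (3.26)–(3.27) p. 395, (3.45), (3.47) p. 398, Thm 3.3 p. 399, (3.69) p. 404,
Thm 3.11 p. 416.  `[Balaban1984PropagatorsII]` (2.3) p. 224.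

CITATION HEADER ∕ WHY THIS FILE (cell `pub-ymgap`, HUMAN RULING D-0062; node N06 = [B9]; seat `pub-ymgap-dag-n06-b` (g22), junction ∕ letter lineage
J-N06→N05).  The (β′-PERIODIC) road (director-ym №217, plan PENS-217) closes the J-N06→N05 junction at PERIODIC members: N05's Proposition 3 on the periodic
model is re-proved from the guarded socket `B8LeafModelZd3SockPer.SockB9P3Per` (dag-n05-w1 g4 `B8LeafModelZdPerProp3OfSockPer`), and cell `lit-balaban`'s
torus datum `torusIdx` reads the same name (words #27 ∕ #28).  THIS FILE is N06's SUPPLIER of that socket at one periodic member, in the frame-free,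
datum-keyed currency of this lineage (`B9SupplySockB9P3ZdDatum.sockB9P3D4βU_at`, g20) but concluding the ORIGINAL five-line shape of (1.59) (no collar
terms: at `Ω 0 = univ` every bond touches `Ω₀`): [B8] p. 86's chain `A′ = G(U₀)J̃`, `J̃ = Δ_a(U₀)A′ = J + Δ′A′ + D R D* A′ + Q*aQ A′`, the Landau letter
kills the third term, `|J̃|₍₋₃₎ ≤ |J|₍₋₃₎ + c₆₉Mα₀|A′|₍₋₁₎ + q|B₁|`, the (3.47)@−3 entries and the Hölder entry of `G(U₀)J̃`, the a-priori step with `θ ≤ ½`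
(`B9SupplySockB9P3Zd.apriori_arith`).  Every analytic input is a DISPLAYED binder on the record `ops`; §3 lists which of them the genuine torus record
`B9SupplySockB9P3ZdAllLettersZdPer.opsAllZdPer` already inhabits (periodicity, `Δ′`-smallness, `Q*aQ`-bound, additivity) and which remain N06's node content on
the torus (`InvAtHIPer` ⟸ Thm 3.11 positivity; `GlobAtIPer` ∕ `HolderAtIPer` ⟸ Thm 3.3); `LandauAtUPer` is discharged here by dag-n06-w4 g6's periodic Landau
orthogonality (`B9Eq321LandauOrthogonalZdPer`, p641654).

WHAT IS DECLARED ∕ PROVED (kernel, 0 sorry; 4 binder `def`s + theorems; no `instance`, no `notation`).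
* §1 BINDERS (periodic-guarded, frame-free): ★ `LandauAtUPer P L ops M i m` (= `LandauAtU` + `IsPeriodic P U₀`, `IsPeriodic P A`), ★ `GlobAtIPer P L ops aT B₀
  M i m` (= `GlobAtI` + `IsPeriodic P U₀`, `J ∈ E_𝔤^per(P)`), ★ `HolderAtIPer P L ops aT Cβ β len M i m` (the (3.45)∕(1.59)₅ Hölder entry of `G(U₀)J`,
  same guards), ★ `PerAtU P L ops M i m` (`Δ_a(U₀)` preserves `E_𝔤^per(P)` at every periodic unitary `U₀`); `landauAtUPer_of_landauAtU`,
  `globAtIPer_of_globAtI`, `globAtIPer_anti`, `holderAtIPer_anti`.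
* §2 ★★★ `sockB9P3Per_at_univ` — at a member with `i.Ω 0 = univ` (`2 ≤ d`, `1 ≤ L`, `1 ≤ M`, `P ≠ 0`): `InvAtHIPer` + `CurvAtInAk` + `LandauAtUPer` +
  `AvgAtP … i.Λb` + `GlobAtIPer` + `HolderAtIPer` + `PerAtU` (+ signs) ⟹ `SockB9P3Per P L (max 1 (2B₀ max 1 q)) (2 (max 0 Cβ) max 1 q)
  (min (1∕16) (min aI (min aT (1∕(2B₀c₆₉M+1))))) β len i.η m i.Ω i.Λs i.Λb`.
* §3 INHABITANTS FOR THE GENUINE TORUS RECORD `opsAllZdPer τ L P i.Λb ops₀`: `avgAtP_of_QQ_eq` (transfer through the `QQ` field), ★ `perAtU_opsAllZdPer`,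
  ★ `curvAtInAk_opsAllZdPer` (`c₆₉ = 14(d−1)`), ★ `avgAtP_opsAllZdPer₀` (under `LevelSepPP0`, `q = qQ d L C_τ β_τ s`), ★★ `landauAtUPer_opsAllZdPer` (dag-n06-w4 g6's
  periodic Landau orthogonality `covDerivFwd_projRPer_covDivB_eq_zero_of_isLandau138` BY NAME), ★★ `sockB9P3Per_opsAllZdPer_of_binders` (§2 with these FOUR
  discharged: the socket at a periodic member from `InvAtHIPer`, `GlobAtIPer`, `HolderAtIPer` ALONE — Thm 3.11 and Thm 3.3 on the torus).

HONEST SCOPE.  (i) Bookkeeping of [B8] p. 86 with displayed binders; NO estimate of [B9] is proved: `GlobAtIPer` ∕ `HolderAtIPer` (Thm 3.3 on the torus) and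
`InvAtHIPer` (Thm 3.11) are hypotheses of the final theorem; per-member inhabitants by compactness ∕ continuity are successor files (dag-n06-w4 g6's announced
periodic (3.25) chain for `InvAtHIPer`, dag-n06-w3 g6's flat kernel); member-UNIFORM constants are N06's node content.  (ii) The supplier is stated for members with
`Ω 0 = univ` only (the (β′) road's members; at `Ω₀ ⊊ ℤᵈ` the collar bookkeeping of EDITION β applies instead).  (iii) Count-neutral; N05 ∕ N06 NOT discharged;
K1⁹ `stmt-QuantumFields-27364` NOT closed; 28∕28 · 5∕27 UNMOVED; one finite `𝕋⁴` programme at fixed `ε`, Bałaban as printed; R4 closes only the conditional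
finite-`𝕋⁴` rung `BalabanLadder.UV` — nothing continuum ∕ ℝ⁴ ∕ OS ∕ mass gap ∕ Clay.  Unit `pub-ymgap-dag-n06-b` (g22), 2026-08-28.
-/

noncomputable section

namespace Literature.MathematicalPhysics.QuantumFieldTheory.Balaban1983to89.B9SupplySockB9P3ZdPer

open B7Prop1Explicit B7Prop2Explicit
open B7Prop1Local (InBox loK bondHiK)
open B7Prop4GeneralLevels (linCovIter)
open B8Ineq132 (covDerivFwd covDeriv InAk BondTouches)
open B8Eq184Proof (cfgExp)
open B8Lemma1NonAbelian (mulCfg)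
open B8Eq140Level (SideTouches)
open B8Eq146AExpansion (iEta plaqCovDeriv)
open B8Eq143PlaqExpansion (pdiv)
open B8Eq155JBound (Jcur wsup)
open B8ScaledSupNorm (bondNorm msup weight Bdd)
open B8Eq138LandauZd (IsLandau138 IsLandau138W covLap)
open B8LeafModelZd (ZdIdx)
open B8LeafModelZd3SockPer (SockB9P3Per)
open B9Eq340HolderZd (hquot AdmPair)
open B9SupplySockB9P3ZdLetters (OpsZd deltaAOf)
open B9SupplySockB9P3ZdLettersOmega (OnDom)
open B9SupplySockB9P3Zd (landau_of_landauW norm_Jcur_le_of_grad bdd_neg_three_of_pointwise apriori_arith)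
open B9SupplySockB9P3ZdGammaInAk (CurvAtInAk)
open B9SupplySockB9P3ZdGammaInAkDpZd (withDpZd curvAtInAk_of_Dp_eq)
open B9SupplySockB9P3ZdGammaUniv (AvgAtP)
open B9SupplySockB9P3ZdDatum (LandauAtU GlobAtI)
open B9Eq316AveragingTransposeZd (betaTau qQ)
open B9Eq316AveragingTransposeZdPrinted (withQQP)
open B9Eq316AveragingTransposeZdLevelZero (LevelSepPP0 avgAtP_withQQP₀)
open B9Eq327GreenZdHermPer (domSubHPer PerPreservingAt InvAtHIPer bondTouches_univ)
open B9SupplySockB9P3ZdAllLettersZdPer (opsAllZdPer opsAllZdPer_DRDs perPreservingAt_opsAllZdPer)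
open T4TermwiseTorus (IsPeriodic)

-- `Site` alone could resolve to the torus sites of `Setup.lean`; re-export the `ℤ^d` sites of `B7Prop1Explicit`.
export B7Prop1Explicit (Site)

variable {d : ℕ} {𝔸 : Type*} [CStarAlgebra 𝔸]

/-! ## §1  The periodic-guarded, frame-free binders -/

section Binders

variable (P L : ℕ)

/-- ★ **THE LANDAU LETTER KILLS PERIODIC LANDAU FIELDS AT EVERY PERIODIC UNITARY BACKGROUND** — `B9SupplySockB9P3ZdDatum.LandauAtU` with two guards
(`U₀`, `A` periodic: the torus `T_P` read on `ℤᵈ`): for every periodic unitary `U₀` and every periodic `A ∈ E(Ω₀)` satisfying the Landau condition (1.38) of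
the member, `(D R(U₀) D* A)(b) = 0` at every bond (print: `R(U₀)` is the projection onto `Δ^η N(Q′)`, (3.20)–(3.21)).
[cite: Balaban1985BackgroundPropagators, (3.20)–(3.21) p.394, (3.26) p.395; Balaban1985RegularSpaces, (1.38) p.82, p.77 («Ω_j = T_η»)] -/
def LandauAtUPer (ops : ℝ → ZdIdx d L → ℕ → OpsZd d 𝔸) (M : ℝ) (i : ZdIdx d L) (m : ℕ) : Prop :=
  ∀ (U₀ : Site d → Fin d → 𝔸ˣ), (∀ x κ, U₀ x κ ∈ unitaryUnits 𝔸) → IsPeriodic P U₀ →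
    ∀ A : Site d → Fin d → 𝔸, IsPeriodic P A → OnDom L m i.η i.Ω A → IsLandau138 L m i.η (i.Ω 0) (i.Λs m) U₀ A →
      ∀ (x : Site d) (μ : Fin d), (ops M i m).DRDs U₀ A x μ = 0

/-- the unguarded binder implies the guarded one. [cite: Balaban1985BackgroundPropagators, (3.20)–(3.21) p.394 (bookkeeping)] -/
theorem landauAtUPer_of_landauAtU {ops : ℝ → ZdIdx d L → ℕ → OpsZd d 𝔸} {M : ℝ} {i : ZdIdx d L} {m : ℕ} (h : LandauAtU L ops M i m) :
    LandauAtUPer P L ops M i m :=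
  fun U₀ hU₀ _ A _ hA hL x μ => h U₀ hU₀ A hA hL x μ

/-- ★ **THE THREE GLOBAL (3.47) ENTRIES OF `G(U₀)` AT `γ = −3` ON THE TORUS** — `B9SupplySockB9P3ZdDatum.GlobAtI` with the guards «`U₀` periodic, `J ∈ E_𝔤^per(P)`»:
for every `α₀ ≤ aT`, every periodic unitary `U₀ ∈ 𝔄_m({Ω_j}, α₀)` and every periodic Hermitian `J`: `|G(U₀)J|₍₋₁₎`, `|∇_{U₀}G(U₀)J|₍₋₂₎`, `|Δ_{U₀}G(U₀)J|₍₋₃₎ ≤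
B₀·|J|₍₋₃₎` — exactly what [B8] p. 86 reads off [B9] Theorem 3.3 for (1.59) lines 1, 2, 4.  A `Prop` on the record (Thm 3.3 on the torus; per member by
compactness, uniformly = N06's node content). [cite: Balaban1985BackgroundPropagators, (3.47) p.398, Thm 3.3 p.399; Balaban1985RegularSpaces, (1.59) p.86, (1.7) p.77, p.77 («Ω_j = T_η»)] -/
def GlobAtIPer (ops : ℝ → ZdIdx d L → ℕ → OpsZd d 𝔸) (aT B₀ : ℝ) (M : ℝ) (i : ZdIdx d L) (m : ℕ) : Prop :=
  ∀ (α₀ : ℝ) (U₀ : Site d → Fin d → 𝔸ˣ), (∀ x κ, U₀ x κ ∈ unitaryUnits 𝔸) → IsPeriodic P U₀ → 0 < α₀ → α₀ ≤ aT → InAk L m i.η α₀ i.Ω U₀ →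
    ∀ J : Site d → Fin d → 𝔸, J ∈ domSubHPer (d := d) (𝔸 := 𝔸) P →
      msup L m i.η (-(1 : ℝ)) (fun j (b : Site d × Fin d) => SideTouches (i.Ω j) b.1 b.2) (fun b => (ops M i m).Gop U₀ J b.1 b.2) ≤
          B₀ * bondNorm L m i.η (-(3 : ℝ)) i.Ω J ∧
        msup L m i.η (-(2 : ℝ)) (fun j (t : Fin d × Fin d × Site d) => SideTouches (i.Ω j) t.2.2 t.2.1)
            (fun t => covDerivFwd i.η U₀ t.1 (fun z => (ops M i m).Gop U₀ J z t.2.1) t.2.2) ≤ B₀ * bondNorm L m i.η (-(3 : ℝ)) i.Ω J ∧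
        bondNorm L m i.η (-(3 : ℝ)) i.Ω (fun x μ => covLap i.η U₀ (fun z => (ops M i m).Gop U₀ J z μ) x) ≤ B₀ * bondNorm L m i.η (-(3 : ℝ)) i.Ω J

/-- the unguarded binder implies the guarded one. [cite: Balaban1985BackgroundPropagators, (3.47) p.398 (bookkeeping)] -/
theorem globAtIPer_of_globAtI {ops : ℝ → ZdIdx d L → ℕ → OpsZd d 𝔸} {aT B₀ M : ℝ} {i : ZdIdx d L} {m : ℕ} (h : GlobAtI L ops aT B₀ M i m) :
    GlobAtIPer P L ops aT B₀ M i m :=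
  fun α₀ U₀ hU₀ _ hα hαT hIn J _ => h α₀ U₀ hU₀ hα hαT hIn J

/-- `GlobAtIPer` is antitone in the threshold `aT` and monotone in the constant `B₀`. [cite: Balaban1985BackgroundPropagators, (3.47) p.398 (bookkeeping)] -/
theorem globAtIPer_anti {ops : ℝ → ZdIdx d L → ℕ → OpsZd d 𝔸} {aT aT' B₀ B₀' : ℝ} (ha : aT' ≤ aT) (hB : B₀ ≤ B₀') {M : ℝ} {i : ZdIdx d L} {m : ℕ}
    (h : GlobAtIPer P L ops aT B₀ M i m) : GlobAtIPer P L ops aT' B₀' M i m := by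
  intro α₀ U₀ hU₀ hper hα hαT hIn J hJ
  obtain ⟨h0, h1, h3⟩ := h α₀ U₀ hU₀ hper hα (hαT.trans ha) hIn J hJ
  have hn : 0 ≤ bondNorm L m i.η (-(3 : ℝ)) i.Ω J := B8ScaledSupNorm.msup_nonneg L m i.hη.le _ _ _
  exact ⟨h0.trans (mul_le_mul_of_nonneg_right hB hn), h1.trans (mul_le_mul_of_nonneg_right hB hn), h3.trans (mul_le_mul_of_nonneg_right hB hn)⟩

/-- ★ **THE HÖLDER ENTRY (3.45) ∕ (1.59)₅ OF `G(U₀)` ON THE TORUS** — for every `α₀ ≤ aT`, every periodic unitary `U₀ ∈ 𝔄_m({Ω_j}, α₀)` and every periodic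
Hermitian `J`: `sup_{j, admissible (x,x′) with x ∈ Ω_j} (Lʲη)^{2+β} |∇_{U₀}(G(U₀)J)(x) − U(Γ)∇_{U₀}(G(U₀)J)(x′)|∕|x−x′|^β ≤ C_β·|J|₍₋₃₎` (the weighted Hölder
quotient `B9Eq340HolderZd.hquot` of [B9] (3.40) over `AdmPair`, read at `γ = −3`).  A `Prop` on the record (Thm 3.3's Hölder member on the torus).
[cite: Balaban1985BackgroundPropagators, (3.45) p.398, (3.40) p.397, Thm 3.3 p.399; Balaban1985RegularSpaces, (1.59) p.86 (the Hölder line), (1.7) p.77] -/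
def HolderAtIPer (ops : ℝ → ZdIdx d L → ℕ → OpsZd d 𝔸) (aT Cβ β : ℝ) (len : Site d → ℝ) (M : ℝ) (i : ZdIdx d L) (m : ℕ) : Prop :=
  ∀ (α₀ : ℝ) (U₀ : Site d → Fin d → 𝔸ˣ), (∀ x κ, U₀ x κ ∈ unitaryUnits 𝔸) → IsPeriodic P U₀ → 0 < α₀ → α₀ ≤ aT → InAk L m i.η α₀ i.Ω U₀ →
    ∀ J : Site d → Fin d → 𝔸, J ∈ domSubHPer (d := d) (𝔸 := 𝔸) P →
      msup L m i.η (-(2 + β)) (fun j (q : Fin d × Fin d × (Site d × Site d)) => q.2.2 ∈ AdmPair i.η len ∧ q.2.2.1 ∈ i.Ω j)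
          (fun q => hquot i.η β len U₀ (covDerivFwd i.η U₀ q.1 (fun z => (ops M i m).Gop U₀ J z q.2.1)) q.2.2) ≤
        Cβ * bondNorm L m i.η (-(3 : ℝ)) i.Ω J

/-- `HolderAtIPer` is antitone in `aT` and monotone in `C_β`. [cite: Balaban1985BackgroundPropagators, (3.45) p.398 (bookkeeping)] -/
theorem holderAtIPer_anti {ops : ℝ → ZdIdx d L → ℕ → OpsZd d 𝔸} {aT aT' Cβ Cβ' β : ℝ} {len : Site d → ℝ} (ha : aT' ≤ aT) (hC : Cβ ≤ Cβ')
    {M : ℝ} {i : ZdIdx d L} {m : ℕ} (h : HolderAtIPer P L ops aT Cβ β len M i m) : HolderAtIPer P L ops aT' Cβ' β len M i m := by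
  intro α₀ U₀ hU₀ hper hα hαT hIn J hJ
  exact (h α₀ U₀ hU₀ hper hα (hαT.trans ha) hIn J hJ).trans
    (mul_le_mul_of_nonneg_right hC (B8ScaledSupNorm.msup_nonneg L m i.hη.le _ _ _))

/-- ★ **`Δ_a(U₀)` OF THE RECORD PRESERVES `E_𝔤^per(P)` AT EVERY PERIODIC UNITARY BACKGROUND** (so the source `J̃ = Δ_a(U₀)A′` of [B8] (1.58) is again a
periodic Hermitian field, which the (3.47) ∕ (3.45) binders read).  For the genuine torus record this is `perPreservingAt_opsAllZdPer` (§3).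
[cite: Balaban1985BackgroundPropagators, (3.26) p.395; Balaban1985RegularSpaces, (1.58) p.86, p.77 («Ω_j = T_η»)] -/
def PerAtU (ops : ℝ → ZdIdx d L → ℕ → OpsZd d 𝔸) (M : ℝ) (i : ZdIdx d L) (m : ℕ) : Prop :=
  ∀ (U₀ : Site d → Fin d → 𝔸ˣ), (∀ x κ, U₀ x κ ∈ unitaryUnits 𝔸) → IsPeriodic P U₀ → PerPreservingAt i.η (ops M i m) P U₀

end Binders

/-! ## §2  The supplier: [B8] p. 86's chain at a periodic member -/

section Supply

variable [Nontrivial 𝔸] (P L : ℕ) (ops : ℝ → ZdIdx d L → ℕ → OpsZd d 𝔸)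

/-- ★★★ **THE PERIODIC-GUARDED SOCKET AT ONE PERIODIC MEMBER FROM THE PERIODIC BINDERS** ([B8] p. 86 «Theorem 3.3 of [4] implies the bounds (1.59)» on the
torus `T_P` read on `ℤᵈ`).  Data: a member `(M, i, m)` with `i.Ω 0 = univ` (the (β′-PERIODIC) road), `2 ≤ d`, `1 ≤ L`, `1 ≤ M`, `P ≠ 0`; the record's
binders `InvAtHIPer` ((3.27) on `E_𝔤^per(P)`, threshold `aI`), `CurvAtInAk` ((3.69), constant `c₆₉`), `LandauAtUPer` ((3.20)–(3.21)), `AvgAtP … i.Λb`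
((3.16), constant `q`), `GlobAtIPer` ((3.47)@−3, threshold `aT`, constant `B₀`), `HolderAtIPer` ((3.45), constant `C_β`), `PerAtU`.  Conclusion:
`SockB9P3Per P L B₀′ B₀β′ cP β len i.η m i.Ω i.Λs i.Λb` with `B₀′ = max{1, 2B₀max{1,q}}`, `B₀β′ = 2·max{0,C_β}·max{1,q}`,
`cP = min{1∕16, aI, aT, 1∕(2B₀c₆₉M+1)}` — the chain: `A′ = G(U₀)J̃` ((1.58)), `J̃ = J + Δ′A′ + 0 + Q*aQA′`, `|J̃|₍₋₃₎ ≤ |J|₍₋₃₎ + c₆₉Mα₀|A′|₍₋₁₎ + q|B₁|`,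
the a-priori step with `θ ≤ ½`; `J̃` is periodic Hermitian by `PerAtU`. [cite: Balaban1985RegularSpaces, (1.58)–(1.59) p.86, Prop. 3 p.87, (1.38) p.82, (1.42) p.83, p.77 («Ω_j = T_η»); Balaban1985BackgroundPropagators, Thm 3.3 p.399, (3.26)–(3.27) p.395, (3.45), (3.47) p.398, (3.69) p.404, (3.16) p.393, (3.20)–(3.21) p.394; Balaban1984PropagatorsII, (2.3) p.224] -/
theorem sockB9P3Per_at_univ [NeZero P] (hd2 : 2 ≤ d) (hL : 1 ≤ L) {c69 q aI aT B₀ Cβ β : ℝ} {len : Site d → ℝ}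
    {M : ℝ} (hM1 : 1 ≤ M) (i : ZdIdx d L) (hΩ : i.Ω 0 = Set.univ) {m : ℕ}
    (hinv : InvAtHIPer P L ops aI M i m) (hcurv : CurvAtInAk L ops c69 M i m) (hlan : LandauAtUPer P L ops M i m)
    (havg : AvgAtP L ops q i.Λb M i m) (hglob : GlobAtIPer P L ops aT B₀ M i m) (hhol : HolderAtIPer P L ops aT Cβ β len M i m)
    (hper : PerAtU P L ops M i m) (hc69 : 0 ≤ c69) (hq : 0 ≤ q) (hB₀ : 0 < B₀) :
    SockB9P3Per (𝔸 := 𝔸) P L (max 1 (2 * B₀ * max 1 q)) (2 * max 0 Cβ * max 1 q)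
      (min (1 / 16) (min aI (min aT (1 / (2 * B₀ * c69 * M + 1))))) β len i.η m i.Ω i.Λs i.Λb := by
  intro α₀ α₂ hα₀ hα₀c hα₂ hα₂c U₀ W hU₀ hWu hU₀p _ hInA _ hLanW A' hsa hA'p h41 hA0
  -- the thresholds
  have hη : 0 < i.η := i.hη
  have hLr : (1 : ℝ) ≤ L := by exact_mod_cast hL
  have hM0 : 0 < M := lt_of_lt_of_le one_pos hM1
  simp only [le_min_iff] at hα₀c hα₂c
  obtain ⟨-, hα₀I, hα₀T, hα₀θ⟩ := hα₀c
  obtain ⟨hα₂16, -, -, -⟩ := hα₂c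
  have hκ' : 0 ≤ c69 * M * α₀ := by positivity
  have hθ : B₀ * (c69 * M * α₀) ≤ 1 / 2 := by
    have hpos : 0 < 2 * B₀ * c69 * M + 1 := by positivity
    have h1 : α₀ * (2 * B₀ * c69 * M + 1) ≤ 1 := (le_div_iff₀ hpos).1 hα₀θ
    nlinarith [hα₀.le, hB₀.le, hκ']
  have hU₀1 : ∀ x κ, U₀ x κ ∈ U1 𝔸 := fun x κ => unitaryUnits_le_U1 (hU₀ x κ)
  -- every bond touches `Ω₀ = ℤᵈ`
  have hb0 : ∀ (y : Site d) (τ : Fin d), BondTouches (i.Ω 0) y τ := fun y τ => by rw [hΩ]; exact bondTouches_univ y τ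
  -- A′ is a field of the class E(Ω₀), periodic and Hermitian
  have hAbd : Bdd L m i.η (-(1 : ℝ)) (fun j (b : Site d × Fin d) => SideTouches (i.Ω j) b.1 b.2) (fun b => A' b.1 b.2) := by
    have e1 : (-(1 : ℝ)) = -((1 : ℕ) : ℝ) := by norm_num
    rw [e1]
    refine B8ScaledSupNorm.bdd_of_forall (c := α₂) fun j hj b hb => ?_
    rw [B8ScaledSupNorm.weight_neg_natCast, pow_one]
    have h := (h41 j hj b.1 b.2 hb).2
    have hs : 0 < (L : ℝ) ^ j * i.η := B8ScaledSupNorm.scale_pos hL hη j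
    calc (L : ℝ) ^ j * i.η * ‖A' b.1 b.2‖ ≤ (L : ℝ) ^ j * i.η * (α₂ * ((L : ℝ) ^ j * i.η)⁻¹) :=
          mul_le_mul_of_nonneg_left h hs.le
      _ = α₂ := by rw [mul_comm α₂, ← mul_assoc, mul_inv_cancel₀ hs.ne', one_mul]
  have hOn : OnDom L m i.η i.Ω A' := ⟨fun y τ h => absurd (hb0 y τ) h, hAbd⟩
  obtain ⟨a, ha_def⟩ : ∃ a : ℝ,
      a = msup L m i.η (-(1 : ℝ)) (fun j (b : Site d × Fin d) => SideTouches (i.Ω j) b.1 b.2) (fun b => A' b.1 b.2) :=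
    ⟨_, rfl⟩
  have ha0 : 0 ≤ a := by rw [ha_def]; exact B8ScaledSupNorm.msup_nonneg L m hη.le _ _ _
  -- the Landau condition for A′; the source J̃ = Δ_a(U₀)A′ and A′ = G(U₀)J̃ ((1.58))
  have hLanA : IsLandau138 L m i.η (i.Ω 0) (i.Λs m) U₀ A' := landau_of_landauW hd2 hη U₀ hWu hα₂16 h41 hLanW
  obtain ⟨Jt, hJt_def⟩ : ∃ Jt : Site d → Fin d → 𝔸, Jt = deltaAOf i.η (ops M i m) U₀ A' := ⟨_, rfl⟩
  have hJtper : Jt ∈ domSubHPer (d := d) (𝔸 := 𝔸) P := by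
    rw [hJt_def]; exact hper U₀ hU₀ hU₀p A' ⟨hA'p, hsa⟩
  have hGJ : (ops M i m).Gop U₀ Jt = A' := by
    rw [hJt_def]; exact hinv α₀ U₀ hU₀ hU₀p hα₀I hInA A' hA'p hOn hsa _ fun y τ _ => rfl
  have hDRD : ∀ (x : Site d) (μ : Fin d), (ops M i m).DRDs U₀ A' x μ = 0 := hlan U₀ hU₀ hU₀p A' hA'p hOn hLanA
  have hJtb : ∀ (x : Site d) (μ : Fin d),
      Jt x μ = Jcur i.η U₀ A' μ x + (ops M i m).Dp U₀ A' x μ + (ops M i m).DRDs U₀ A' x μ + (ops M i m).QQ U₀ A' x μ := by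
    intro x μ; rw [hJt_def]; rfl
  -- the right-hand side of the socket: |J|₍₋₃₎ and |B₁|
  obtain ⟨nJ, hnJ_def⟩ : ∃ nJ : ℝ, nJ = bondNorm L m i.η (-(3 : ℝ)) i.Ω (fun x μ => Jcur i.η U₀ A' μ x) := ⟨_, rfl⟩
  obtain ⟨nB, hnB_def⟩ : ∃ nB : ℝ, nB = wsup 1 (fun p : {p : ℕ × (Site d × Fin d) // p.1 ≤ m ∧ p.2 ∈ i.Λb m p.1} =>
      linCovIter L U₀ (iEta i.η A') p.1.1 p.1.2.1 p.1.2.2) := ⟨_, rfl⟩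
  have hnJ0 : 0 ≤ nJ := by rw [hnJ_def]; exact B8ScaledSupNorm.msup_nonneg L m hη.le _ _ _
  have hnB0 : 0 ≤ nB := by rw [hnB_def]; exact B8Eq155JBound.wsup_nonneg zero_le_one _
  -- J is bounded (A′ is): the real supremum |J|₍₋₃₎ is attained
  have hAglob : ∀ (y : Site d) (τ : Fin d), ‖A' y τ‖ ≤ α₂ * i.η⁻¹ := by
    intro y τ
    by_cases hmem : ∃ j, j ≤ m ∧ SideTouches (i.Ω j) y τ
    · obtain ⟨j, hj, hs⟩ := hmem
      have hLj : (1 : ℝ) ≤ (L : ℝ) ^ j := one_le_pow₀ hLr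
      calc ‖A' y τ‖ ≤ α₂ * ((L : ℝ) ^ j * i.η)⁻¹ := (h41 j hj y τ hs).2
        _ = α₂ * i.η⁻¹ * ((L : ℝ) ^ j)⁻¹ := by rw [mul_inv]; ring
        _ ≤ α₂ * i.η⁻¹ * 1 := by
            apply mul_le_mul_of_nonneg_left (inv_le_one_of_one_le₀ hLj) (by positivity)
        _ = α₂ * i.η⁻¹ := mul_one _
    · rw [hA0 y τ fun j hj hs => hmem ⟨j, hj, hs⟩, norm_zero]
      positivity
  have hgrad : ∀ (y : Site d) (κ τ : Fin d), ‖covDerivFwd i.η U₀ κ (fun z => A' z τ) y‖ ≤ 2 * α₂ * i.η⁻¹ * i.η⁻¹ := by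
    intro y κ τ
    unfold covDerivFwd
    rw [norm_smul, norm_inv, Real.norm_eq_abs, abs_of_pos hη]
    have h1 : ‖B7Eq78Linearization.conjR (U₀ y κ) (A' (y + e κ) τ) - A' y τ‖ ≤ α₂ * i.η⁻¹ + α₂ * i.η⁻¹ := by
      calc ‖B7Eq78Linearization.conjR (U₀ y κ) (A' (y + e κ) τ) - A' y τ‖
          ≤ ‖B7Eq78Linearization.conjR (U₀ y κ) (A' (y + e κ) τ)‖ + ‖A' y τ‖ := norm_sub_le _ _
        _ ≤ α₂ * i.η⁻¹ + α₂ * i.η⁻¹ := by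
            rw [B8Ineq132.norm_conjR (hU₀1 y κ)]
            exact add_le_add (hAglob _ _) (hAglob _ _)
    calc i.η⁻¹ * ‖B7Eq78Linearization.conjR (U₀ y κ) (A' (y + e κ) τ) - A' y τ‖
        ≤ i.η⁻¹ * (α₂ * i.η⁻¹ + α₂ * i.η⁻¹) := mul_le_mul_of_nonneg_left h1 (by positivity)
      _ = 2 * α₂ * i.η⁻¹ * i.η⁻¹ := by ring
  have hJbd : Bdd L m i.η (-(3 : ℝ)) (fun j (b : Site d × Fin d) => BondTouches (i.Ω j) b.1 b.2)
      (fun b => Jcur i.η U₀ A' b.2 b.1) :=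
    bdd_neg_three_of_pointwise hL hη fun b => norm_Jcur_le_of_grad hη hU₀1 hgrad b.2 b.1
  -- |J̃|₍₋₃₎ ≤ |J|₍₋₃₎ + c₆₉ M α₀ |A′|₍₋₁₎ + q |B₁| (pointwise: (3.26) with (3.69), the Landau condition, (3.16))
  have hJt : bondNorm L m i.η (-(3 : ℝ)) i.Ω Jt ≤ nJ + c69 * M * α₀ * a + q * nB := by
    have e3 : (-(3 : ℝ)) = -((3 : ℕ) : ℝ) := by norm_num
    refine B8ScaledSupNorm.msup_le (by positivity) fun j hj b hb => ?_
    have hw : weight L i.η (-(3 : ℝ)) j = ((L : ℝ) ^ j * i.η) ^ 3 := by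
      rw [e3, B8ScaledSupNorm.weight_neg_natCast]
    have hw0 : 0 ≤ ((L : ℝ) ^ j * i.η) ^ 3 := by positivity
    have h1 : weight L i.η (-(3 : ℝ)) j * ‖Jcur i.η U₀ A' b.2 b.1‖ ≤ nJ := by
      rw [hnJ_def]; exact B8ScaledSupNorm.weight_mul_norm_le_msup hJbd hj hb
    have h2 : ((L : ℝ) ^ j * i.η) ^ 3 * ‖(ops M i m).Dp U₀ A' b.1 b.2‖ ≤ c69 * M * α₀ * a := by
      rw [ha_def]; exact hcurv α₀ U₀ hU₀ hα₀ hInA A' hOn j hj b.1 b.2 hb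
    have h4 : ((L : ℝ) ^ j * i.η) ^ 3 * ‖(ops M i m).QQ U₀ A' b.1 b.2‖ ≤ q * nB := by
      rw [hnB_def]; exact havg U₀ hU₀ A' hOn j hj b.1 b.2 hb
    have hsum : ‖Jt b.1 b.2‖ ≤
        ‖Jcur i.η U₀ A' b.2 b.1‖ + ‖(ops M i m).Dp U₀ A' b.1 b.2‖ + ‖(ops M i m).QQ U₀ A' b.1 b.2‖ := by
      rw [hJtb, hDRD b.1 b.2, add_zero]
      exact norm_add₃_le
    rw [hw] at h1 ⊢
    calc ((L : ℝ) ^ j * i.η) ^ 3 * ‖Jt b.1 b.2‖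
        ≤ ((L : ℝ) ^ j * i.η) ^ 3 *
            (‖Jcur i.η U₀ A' b.2 b.1‖ + ‖(ops M i m).Dp U₀ A' b.1 b.2‖ + ‖(ops M i m).QQ U₀ A' b.1 b.2‖) :=
          mul_le_mul_of_nonneg_left hsum hw0
      _ = ((L : ℝ) ^ j * i.η) ^ 3 * ‖Jcur i.η U₀ A' b.2 b.1‖ + ((L : ℝ) ^ j * i.η) ^ 3 * ‖(ops M i m).Dp U₀ A' b.1 b.2‖ +
            ((L : ℝ) ^ j * i.η) ^ 3 * ‖(ops M i m).QQ U₀ A' b.1 b.2‖ := by ring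
      _ ≤ nJ + c69 * M * α₀ * a + q * nB := add_le_add (add_le_add h1 h2) h4
  -- Theorem 3.3's γ = −3 entries at J̃ ((3.47) ⇒ (1.59) lines 1, 2, 4), and the Hölder entry (line 5)
  obtain ⟨hG0, hG1, hG3⟩ := hglob α₀ U₀ hU₀ hU₀p hα₀ hα₀T hInA Jt hJtper
  rw [hGJ] at hG0 hG1 hG3
  have hline1 : a ≤ B₀ * bondNorm L m i.η (-(3 : ℝ)) i.Ω Jt := by rw [ha_def]; exact hG0
  have hline5 : msup L m i.η (-(2 + β))
      (fun j (q : Fin d × Fin d × (Site d × Site d)) => q.2.2 ∈ AdmPair i.η len ∧ q.2.2.1 ∈ i.Ω j)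
      (fun q => hquot i.η β len U₀ (covDerivFwd i.η U₀ q.1 (fun z => A' z q.2.1)) q.2.2) ≤
      max 0 Cβ * bondNorm L m i.η (-(3 : ℝ)) i.Ω Jt := by
    have h := hhol α₀ U₀ hU₀ hU₀p hα₀ hα₀T hInA Jt hJtper
    rw [hGJ] at h
    exact h.trans (mul_le_mul_of_nonneg_right (le_max_right _ _) (B8ScaledSupNorm.msup_nonneg L m hη.le _ _ _))
  -- the a-priori (Neumann) step, in the concrete norms
  have hJJ : bondNorm L m i.η (-(3 : ℝ)) i.Ω (fun x μ => pdiv i.η U₀ (plaqCovDeriv i.η U₀ A') μ x) = nJ := by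
    rw [hnJ_def]; rfl
  rw [← ha_def, ← hnJ_def, ← hnB_def]
  exact apriori_arith hB₀ hq hκ' hθ ha0 hnJ0 hnB0 (le_max_left 0 _) hJJ hJt hline1 hG1 hG3 hline5

end Supply

/-! ## §3  Which binders the genuine torus record `opsAllZdPer` already inhabits -/

section Genuine

variable (L : ℕ)

/-- **`AvgAtP` READS ONLY THE `QQ` FIELD**: it transfers between records with the same `Q*aQ` letter at the member.
[cite: Balaban1985BackgroundPropagators, (3.16) p.393 (bookkeeping)] -/
theorem avgAtP_of_QQ_eq {ops ops' : ℝ → ZdIdx d L → ℕ → OpsZd d 𝔸} {M : ℝ} {i : ZdIdx d L} {m : ℕ} (hQQ : (ops M i m).QQ = (ops' M i m).QQ)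
    {q : ℝ} {ΛbP : ℕ → ℕ → Set (Site d × Fin d)} (h : AvgAtP L ops' q ΛbP M i m) : AvgAtP L ops q ΛbP M i m := by
  intro U₀ hU₀ A hA j hj x μ hb
  rw [hQQ]
  exact h U₀ hU₀ A hA j hj x μ hb

variable (τ : 𝔸 →ₗ[ℂ] ℂ) (P : ℕ) [Nontrivial 𝔸] [FiniteDimensional ℝ 𝔸] [NeZero P]

/-- ★ **`PerAtU` FOR THE GENUINE TORUS RECORD** at a periodic member: `L ≥ 2`, faithful Hermitian tracial `τ`, `Lᵐ ∣ P`, periodic class sections, the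
(1.31) box law at levels `j ≥ 1` (`perPreservingAt_opsAllZdPer` at every periodic unitary `U₀`). [cite: Balaban1985BackgroundPropagators, (3.26) p.395; Balaban1985RegularSpaces, (1.31) p.82, p.77 («Ω_j = T_η»)] -/
theorem perAtU_opsAllZdPer (hL : 2 ≤ L) (hτp : ∀ a : 𝔸, a ≠ 0 → 0 < (τ (star a * a)).re)
    (hτt : ∀ a b : 𝔸, τ (a * b) = τ (b * a)) (hτs : ∀ a : 𝔸, τ (star a) = starRingEnd ℂ (τ a))
    (ΛbP : ℕ → ℕ → Set (Site d × Fin d)) (ops₀ : ℝ → ZdIdx d L → ℕ → OpsZd d 𝔸) (M : ℝ) (i : ZdIdx d L) {m : ℕ} (hdvd : L ^ m ∣ P)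
    (hΛ : ∀ j, j ≤ m → ∀ κ : Fin d, IsPeriodic (P / L ^ j) (fun z => (z, κ) ∈ ΛbP m j))
    (hbox : ∀ j, 1 ≤ j → j ≤ m → ∀ c ∈ ΛbP m j, ∀ x, InBox (loK L j c.1) (bondHiK L j c.1 c.2) x → x ∈ i.Ω (j - 1)) :
    PerAtU P L (opsAllZdPer τ L P ΛbP ops₀) M i m :=
  fun _ hUu hU => perPreservingAt_opsAllZdPer τ P hL hτp hτt hτs ΛbP ops₀ M i hUu hU hdvd hΛ hbox

omit [NeZero P] in
/-- ★ **`CurvAtInAk` FOR THE GENUINE TORUS RECORD** (`1 ≤ L`, `1 ≤ M`; constant `c₆₉ = 14(d−1)`): its `Dp` is the genuine `Δ′`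
(`B9SupplySockB9P3ZdGammaInAkDpZd.curvAtInAk_of_Dp_eq`). [cite: Balaban1985BackgroundPropagators, (3.69) p.404, (3.10) p.392; Balaban1985RegularSpaces, (1.7) p.77, (1.59) p.86] -/
theorem curvAtInAk_opsAllZdPer (hL : 1 ≤ L) (ΛbP : ℕ → ℕ → Set (Site d × Fin d)) (ops₀ : ℝ → ZdIdx d L → ℕ → OpsZd d 𝔸) {M : ℝ}
    (hM : 1 ≤ M) (i : ZdIdx d L) (m : ℕ) : CurvAtInAk L (opsAllZdPer τ L P ΛbP ops₀) (14 * ((d - 1 : ℕ) : ℝ)) M i m :=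
  curvAtInAk_of_Dp_eq hL (fun _ _ _ => rfl) hM i m

omit [NeZero P] in
/-- ★ **`AvgAtP` FOR THE GENUINE TORUS RECORD UNDER EDITION P₀'s LAW** (`2 ≤ d`, `2 ≤ L`, `C_τ`, `LevelSepPP0 L m i.Ω ΛbP s`; `q = qQ d L C_τ β_τ s`): its
`QQ` is EDITION P's `Q*aQ` (`B9Eq316AveragingTransposeZdLevelZero.avgAtP_withQQP₀` through the `QQ` field).
[cite: Balaban1985BackgroundPropagators, (3.16) p.393; Balaban1985RegularSpaces, (1.56), (1.58)–(1.59) p.86, (1.31) p.82; Balaban1985Averaging, (147) p.40] -/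
theorem avgAtP_opsAllZdPer₀ (hd : 2 ≤ d) (hL : 2 ≤ L) {Cτ : ℝ} (hCτ : ∀ x y : 𝔸, |(τ (star x * y)).re| ≤ Cτ * ‖x‖ * ‖y‖)
    (ΛbP : ℕ → ℕ → Set (Site d × Fin d)) (ops₀ : ℝ → ZdIdx d L → ℕ → OpsZd d 𝔸) (M : ℝ) (i : ZdIdx d L) (m : ℕ) {s : ℕ}
    (hlaw : LevelSepPP0 L m i.Ω ΛbP s) :
    AvgAtP L (opsAllZdPer τ L P ΛbP ops₀) (qQ d L Cτ (betaTau τ) s) ΛbP M i m :=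
  avgAtP_of_QQ_eq L (ops' := withQQP τ L ΛbP ops₀) rfl (avgAtP_withQQP₀ τ L hd hL hCτ ΛbP ops₀ M i m hlaw)

omit [Nontrivial 𝔸] in
/-- ★★ **`LandauAtUPer` FOR THE GENUINE TORUS RECORD — DISCHARGED** at every member of the (β′-PERIODIC) road (`i.Ω 0 = univ`, `L ≠ 0`, `Lᵐ ∣ P`; faithful
Hermitian tracial `τ`, f.d. fibre): for every periodic unitary `U₀` and periodic `A` in the Landau gauge of record, `(D^η_{U₀} R^per(U₀) D^{η*}_{U₀} A)(b) = 0` —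
dag-n06-w4 g6's periodic Landau orthogonality `B9Eq321LandauOrthogonalZdPer.covDerivFwd_projRPer_covDivB_eq_zero_of_isLandau138` BY NAME.
[cite: Balaban1985RegularSpaces, (1.42) p.83, (1.58) p.86, (1.38) p.82, p.77 («Ω_j = T_η»); Balaban1985BackgroundPropagators, (3.20)–(3.22) p.394, (3.26) p.395] -/
theorem landauAtUPer_opsAllZdPer [NeZero L] (hτp : ∀ a : 𝔸, a ≠ 0 → 0 < (τ (star a * a)).re)
    (hτt : ∀ a b : 𝔸, τ (a * b) = τ (b * a)) (hτs : ∀ a : 𝔸, τ (star a) = starRingEnd ℂ (τ a))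
    (ΛbP : ℕ → ℕ → Set (Site d × Fin d)) (ops₀ : ℝ → ZdIdx d L → ℕ → OpsZd d 𝔸) (M : ℝ) (i : ZdIdx d L) (hΩ : i.Ω 0 = Set.univ) {m : ℕ}
    (hdvd : L ^ m ∣ P) : LandauAtUPer P L (opsAllZdPer τ L P ΛbP ops₀) M i m := by
  intro U₀ hUu hU A hA _ hLan x μ
  rw [opsAllZdPer_DRDs]
  rw [hΩ] at hLan
  exact B9Eq321LandauOrthogonalZdPer.covDerivFwd_projRPer_covDivB_eq_zero_of_isLandau138 hτt hτs hτp hUu hU hdvd hA hLan μ x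

/-- ★★ **THE PERIODIC SOCKET FOR THE GENUINE TORUS RECORD AT ITS OWN LAW CLASS, FROM THE THREE ANALYTIC BINDERS ALONE**: at a member `(M, i, m)` with
`i.Ω 0 = univ`, `2 ≤ d`, `2 ≤ L`, `1 ≤ M`, `P ≠ 0`, faithful Hermitian tracial `τ` with `C_τ`, `Lᵐ ∣ P`, the member's class `i.Λb` with periodic sections and
EDITION P₀'s law `LevelSepPP0 L m i.Ω i.Λb s` (so the (1.31) box clause holds at `j ≥ 1`): `InvAtHIPer` (Thm 3.11) + `GlobAtIPer` + `HolderAtIPer` (Thm 3.3)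
for `opsAllZdPer τ L P i.Λb ops₀` ⟹ `SockB9P3Per P L B₀′ B₀β′ cP β len i.η m i.Ω i.Λs i.Λb` (§2 with `PerAtU`, `CurvAtInAk`, `AvgAtP`, `LandauAtUPer` discharged
by name; `c₆₉ = 14(d−1)`, `q = qQ d L C_τ β_τ s`). [cite: Balaban1985RegularSpaces, (1.58)–(1.59) p.86, Prop. 3 p.87, p.77 («Ω_j = T_η»); Balaban1985BackgroundPropagators, Thm 3.3 p.399, Thm 3.11 p.416, (3.26)–(3.27) p.395, (3.69) p.404, (3.16) p.393, (3.20)–(3.22) p.394] -/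
theorem sockB9P3Per_opsAllZdPer_of_binders (hd2 : 2 ≤ d) (hL : 2 ≤ L) (hτp : ∀ a : 𝔸, a ≠ 0 → 0 < (τ (star a * a)).re)
    (hτt : ∀ a b : 𝔸, τ (a * b) = τ (b * a)) (hτs : ∀ a : 𝔸, τ (star a) = starRingEnd ℂ (τ a))
    {Cτ : ℝ} (hCτ : ∀ x y : 𝔸, |(τ (star x * y)).re| ≤ Cτ * ‖x‖ * ‖y‖)
    (ops₀ : ℝ → ZdIdx d L → ℕ → OpsZd d 𝔸) {M : ℝ} (hM1 : 1 ≤ M) (i : ZdIdx d L) (hΩ : i.Ω 0 = Set.univ) {m s : ℕ} (hdvd : L ^ m ∣ P)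
    (hΛ : ∀ j, j ≤ m → ∀ κ : Fin d, IsPeriodic (P / L ^ j) (fun z => (z, κ) ∈ i.Λb m j)) (hlaw : LevelSepPP0 L m i.Ω i.Λb s)
    {aI aT B₀ Cβ β : ℝ} {len : Site d → ℝ}
    (hinv : InvAtHIPer P L (opsAllZdPer τ L P i.Λb ops₀) aI M i m)
    (hglob : GlobAtIPer P L (opsAllZdPer τ L P i.Λb ops₀) aT B₀ M i m) (hhol : HolderAtIPer P L (opsAllZdPer τ L P i.Λb ops₀) aT Cβ β len M i m)
    (hB₀ : 0 < B₀) :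
    SockB9P3Per (𝔸 := 𝔸) P L (max 1 (2 * B₀ * max 1 (qQ d L Cτ (betaTau τ) s))) (2 * max 0 Cβ * max 1 (qQ d L Cτ (betaTau τ) s))
      (min (1 / 16) (min aI (min aT (1 / (2 * B₀ * (14 * ((d - 1 : ℕ) : ℝ)) * M + 1))))) β len i.η m i.Ω i.Λs i.Λb := by
  have hL1 : 1 ≤ L := le_trans (by norm_num) hL
  have hbox : ∀ j, 1 ≤ j → j ≤ m → ∀ c ∈ i.Λb m j, ∀ x, InBox (loK L j c.1) (bondHiK L j c.1 c.2) x → x ∈ i.Ω (j - 1) :=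
    fun j hj1 hj c hc x hx => (hlaw j hj c hc x hx).1 hj1
  have hq : 0 ≤ qQ d L Cτ (betaTau τ) s := by
    have hCτ0 : 0 ≤ Cτ := by
      have h := hCτ 1 1
      rw [star_one, one_mul, norm_one, mul_one, mul_one] at h
      exact le_trans (abs_nonneg _) h
    have hβ : 0 ≤ betaTau τ := by
      unfold betaTau
      split_ifs
      · exact Finset.sum_nonneg fun i _ => mul_nonneg (norm_nonneg _) (norm_nonneg _)
      · exact le_rfl
    have hα : 0 ≤ B9Eq316AveragingTransposeZd.alphaQ d L := (B9Eq316AveragingTransposeZd.alphaQ_pos d hL1).le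
    have hθ : 0 ≤ B7Prop5GeneralLevels.thetaGen d L (B9Eq316AveragingTransposeZd.alphaQ d L) := by
      unfold B7Prop5GeneralLevels.thetaGen; positivity
    unfold qQ; positivity
  haveI : NeZero L := ⟨by omega⟩
  exact sockB9P3Per_at_univ P L (opsAllZdPer τ L P i.Λb ops₀) hd2 hL1 hM1 i hΩ hinv (curvAtInAk_opsAllZdPer L τ P hL1 i.Λb ops₀ hM1 i m)
    (landauAtUPer_opsAllZdPer L τ P hτp hτt hτs i.Λb ops₀ M i hΩ hdvd)
    (avgAtP_opsAllZdPer₀ L τ P hd2 hL hCτ i.Λb ops₀ M i m hlaw) hglob hhol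
    (perAtU_opsAllZdPer L τ P hL hτp hτt hτs i.Λb ops₀ M i hdvd hΛ hbox) (by positivity) hq hB₀

end Genuine

end Literature.MathematicalPhysics.QuantumFieldTheory.Balaban1983to89.B9SupplySockB9P3ZdPer

end
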